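import Summits.QuantumFields.YangMills.Theorems.UnitScaleTiltProp7SymAvgRelativeBound
import Summits.QuantumFields.YangMills.Theorems.UnitScaleTiltProp8ChartDiffBall
import HarnessLib

/-!
# Route `UnitScaleTilt`, crux K1 child «MinimiserStabilityRegPr» (stmt-QuantumFields-19200), stub `stub_existenceMinimalOrbit` (EX), route (α), node (AVG-SYM) —
# (AVG-SYM-AN): **ℂ-DIFFERENTIABILITY OF THE RELATIVE k-FOLD (0.4) AVERAGE `A ↦ Ū^{(k)}[e^{iηA}U₀♭](e)·(Ū^{(k)}[U₀♭](e))⁻¹` AT EVERY COMPLEX `A₀` OF THE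
# SMALL SUP-BALL, AT A CURVED PLAQUETTE-SMALL BACKGROUND `U₀`** — the analytic input (AN) of ★w2-20520 g2's Schwarz reduction `Inputs ⇐ (AN) + (BD)`
# (`Prop7AnalyticRemainderInputs`, p599231) for the CHART-47 supplier `Chart47T3sym` (OWNER RULING g25-№3), companion of `Prop7SymAvgRelativeBound` ((BD))

Cell `ym3-torus`, width seat `ym-ust-20520-w4` (gen 2; OWNER ym3-torus-plan g25 03:02:10Z «FIRST the (AN) companion (product-with-fixed-near-1-field variant of
`differentiableAt_coe_emlIterU_of_reads` at the gauged field + `A ↦ Ad_û A` linear isometry — one induction on `Prop8ChartDiffLocal.differentiableAt_coe_emlAvgU_of_twoBlock`)»).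
YM₃ on T³ is a ladder rung (R3), NOT the Clay problem; nothing here is a claim about the stub, the crux, d = 4 or the mass gap.  `--supports stmt-QuantumFields-19200
--as helper`; count-neutral.

THE PRINT.  [Balaban1987RG1] p. 253: *«It is a Gᶜ-valued function defined on sets {U_j} … with sufficiently small diameters … we assume that it is an analytic
function»* — the complexified (0.4) average is analytic on its small-loop domain; [Balaban1985Averaging] (11)–(12) p. 19 (gauge covariance), Prop. 4 p. 38.

WHAT THIS FILE PROVES (sorry-free; no definition; [folklore] bookkeeping over the ★19200-p2∕p1 `Prop8Chart*` lineage).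
* §1 ★`differentiableAt_coe_emlIterU_family_of_reads` — the FIELD-GENERIC twin of `Prop8ChartDiffBall.differentiableAt_coe_emlIterU_of_reads`: for ANY family
  `F : E → GaugeField P 0 𝔸ˣ` (E a complex normed space, 𝔸 a complete normed ℂ-algebra) which is bondwise ℂ-differentiable at `x₀` and whose bonds at `x₀` are
  within `s₀` of `1` under the `i`-blocks of `S`, budget `6400ℓ²Lⁱs₀ ≤ 1`: `x ↦ Ū^{(i)}[F x](e)` is ℂ-differentiable at `x₀` for every `i`-bond `e` with ends in `S`
  (the same induction: `differentiableAt_coe_emlAvgU_of_twoBlock` + the k-uniform near-flatness `norm_emlIterU_sub_one_le_of_reads` + `norm_loopHolU_sub_one_lt_one`).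
* §2 `differentiableAt_coe_gaugeActT_mul` (bondwise differentiability of the gauged perturbed family `A ↦ (e^{iηA}·V)^{û}(b)` — products with constants),
  `coe_emlIterU_eq_conj_gauged` (`Ū^{(k)}[V](e) = û^{(k)}(e₋)⁻¹·Ū^{(k)}[V^{û}](e)·û^{(k)}(e₊)`, `Prop8Chart.emlIterU_gaugeActT`).
* §3 (𝔸 = M₂(ℂ), SU(2) background) ★★**`differentiableAt_relIter_of_plaqSmall`** — for `U₀ : GaugeField P 0 SU(2)` with `PlaqSmall a₀ U₀`, `k + 1 ≤ m + K`, and EVERY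
  complex `A₀` with `‖ηA₀(b)‖ ≤ t ≤ 1` bondwise, under the budget of `Prop7SymAvgRelativeBound.norm_relIter_sub_one_le_of_plaqSmall`:
  `A ↦ Ū^{(k)}[e^{iηA}·U₀♭](e)·(Ū^{(k)}[U₀♭](e))⁻¹` is ℂ-differentiable at `A₀`, for every `k`-bond `e` — i.e. the relative quantity whose `mlog` is ★w1-19200 g2's
  `logChartSym` (`Prop7Chart47T3Sym`; bridge `Prop7SymAvgGLBridge.descendToGL_eq_fieldShift_emlIterU`) is holomorphic on the whole small sup-ball, the radius
  depending on `d, L` only (k-UNIFORM).  Proof: cluster axial gauge (`IterPlaqSmallAllL.dist1_axial_cluster_le`), §1 at the gauged family, §2 to undo the gauge.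
HONEST SCOPE.  Bookkeeping; every estimate is the `Prop8Chart*` lineage's; (AN) + (BD) ⟹ `B11Prop3Model.Inputs (CmapSym U₀) …` is ★w2-20520 g2's
`inputs_linRemainder_of_analyticOnNhd_of_bound` (p599231) + ★w1's `CmapSym_eq_linRemainder` (p600171), not here.

References: T. Bałaban, CMP **109** (1987) 249–301 [Balaban1987RG1] ((0.4)–(0.11) p.253, (0.21) p.256); CMP **98** (1985) 17–51 [Balaban1985Averaging]
((11)–(12) p.19, Prop. 4 (134)–(135) p.38); CMP **102** (1985) 277–309 [Balaban1985Variational] ((44)–(48) p.285, (152) p.301).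
-/

noncomputable section

open scoped BigOperators
open NormedSpace

namespace Summit.QuantumFields.YangMills.Theorems.Prop7SymAvgRelativeBound

open Literature.MathematicalPhysics.QuantumFieldTheory.Balaban1983to89
open T4Continuum BlockAveraging
open B5Eq118OneStroke (iterBlockOf iterBlockOf_succ iterBlockOf_zero)
open B15DeterminingSets (embIter)
open B10Eq27TorusAxialLog (axialT gaugeActT gaugeActT_apply unitsField toUField suIncl)
open Summit.QuantumFields.YangMills.Theorems.Prop8Chart (expCfg coe_expCfg emlAvgU emlIterU emlIterU_zero emlIterU_succ emlIterU_gaugeActT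
  norm_emlIterU_sub_one_le_of_reads coe_unitsField_toUField differentiableAt_coe_emlAvgU_of_twoBlock norm_loopHolU_sub_one_lt_one
  differentiableAt_coe_expCfg differentiableAt_coe_inv)
open Summit.QuantumFields.YangMills.Theorems.IterPlaqSmallAllL (dist1_axial_cluster_le)

variable {P : Params}

/-! ## §1 The iterated average of a differentiable family with small reads -/

section Generic

variable {𝔸 : Type*} [NormedRing 𝔸] [NormedAlgebra ℂ 𝔸] [CompleteSpace 𝔸] [NormOneClass 𝔸]
variable {E : Type*} [NormedAddCommGroup E] [NormedSpace ℂ E]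

/-- **`x ↦ Ū^{(i)}[F x](e)` IS ℂ-DIFFERENTIABLE AT EVERY `x₀` WHERE THE FAMILY IS BONDWISE DIFFERENTIABLE AND ITS BONDS ARE WITHIN `s₀` OF `1` UNDER THE TWO
BLOCKS OF `e`** (budget `6400ℓ²Lⁱs₀ ≤ 1`; the field-generic twin of `Prop8ChartDiffBall.differentiableAt_coe_emlIterU_of_reads`, same induction).
[cite: Balaban1987RG1, (0.4) p.253, (0.21) p.256] -/
theorem differentiableAt_coe_emlIterU_family_of_reads (F : E → GaugeField P 0 𝔸ˣ) (x₀ : E)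
    (hF0 : ∀ b : PBond P 0, DifferentiableAt ℂ (fun x => ((F x b : 𝔸ˣ) : 𝔸)) x₀) :
    ∀ (i : ℕ), i ≤ P.m + P.K → ∀ (S : Set (Site P i)) (s₀ : ℝ), 0 ≤ s₀ →
      6400 * (((P.d + 2) * P.L : ℕ) : ℝ) ^ 2 * (P.L : ℝ) ^ i * s₀ ≤ 1 →
      (∀ b : PBond P 0, iterBlockOf i b.src ∈ S → iterBlockOf i b.tgt ∈ S → ‖((F x₀ b : 𝔸ˣ) : 𝔸) - 1‖ ≤ s₀) →
      ∀ e : PBond P i, e.src ∈ S → e.tgt ∈ S →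
        DifferentiableAt ℂ (fun x : E => ((emlIterU i (F x) e : 𝔸ˣ) : 𝔸)) x₀ := by
  set ℓ : ℝ := (((P.d + 2) * P.L : ℕ) : ℝ) with hℓ
  have hℓ1 : (1 : ℝ) ≤ ℓ := by
    rw [hℓ]; exact_mod_cast Nat.one_le_iff_ne_zero.mpr (Nat.mul_ne_zero (by omega) (by have := P.hL.2; omega))
  have hℓ0 : (0 : ℝ) ≤ ℓ := by linarith
  have hL1 : (1 : ℝ) ≤ P.L := by exact_mod_cast P.L_pos
  intro i
  induction i with
  | zero =>
    intro _ S s₀ _ _ _ e _ _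
    simpa only [emlIterU_zero] using hF0 e
  | succ i ih =>
    intro hi S s₀ hs₀ hbudget hA c hcs hct
    have hbudget_i : 6400 * ℓ ^ 2 * (P.L : ℝ) ^ i * s₀ ≤ 1 := by
      refine le_trans ?_ hbudget
      have : (P.L : ℝ) ^ i ≤ (P.L : ℝ) ^ (i + 1) := pow_le_pow_right₀ hL1 (Nat.le_succ i)
      have h0 : 0 ≤ 6400 * ℓ ^ 2 * s₀ := by positivity
      nlinarith
    set S' : Set (Site P i) := {y | blockOf y ∈ S} with hS'
    have hA' : ∀ b : PBond P 0, iterBlockOf i b.src ∈ S' → iterBlockOf i b.tgt ∈ S' → ‖((F x₀ b : 𝔸ˣ) : 𝔸) - 1‖ ≤ s₀ :=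
      fun b hs ht => hA b (by rw [iterBlockOf_succ]; exact hs) (by rw [iterBlockOf_succ]; exact ht)
    have hF : ∀ e : PBond P i, e.src ∈ S' → e.tgt ∈ S' →
        DifferentiableAt ℂ (fun x : E => ((emlIterU i (F x) e : 𝔸ˣ) : 𝔸)) x₀ :=
      ih (Nat.le_of_succ_le hi) S' s₀ hs₀ hbudget_i hA'
    -- near-flatness of the level-`i` averages under `S`
    have hnear : ∀ e : PBond P i, e.src ∈ S' → e.tgt ∈ S' →
        ‖((emlIterU i (F x₀) e : 𝔸ˣ) : 𝔸) - 1‖ ≤ 30 * ℓ * (P.L : ℝ) ^ i * s₀ :=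
      fun e hs ht => norm_emlIterU_sub_one_le_of_reads (Nat.le_of_succ_le hi) S' (F x₀) hs₀ hbudget_i hA' e hs ht
    have hfun : (fun x : E => ((emlIterU (i + 1) (F x) c : 𝔸ˣ) : 𝔸)) = fun x => ((emlAvgU (emlIterU i (F x)) c : 𝔸ˣ) : 𝔸) := by
      funext x; rw [emlIterU_succ]
    rw [hfun]
    have hmem : ∀ b : PBond P i, (blockOf b.src = c.src ∨ blockOf b.src = c.tgt) → (blockOf b.tgt = c.src ∨ blockOf b.tgt = c.tgt) →
        b.src ∈ S' ∧ b.tgt ∈ S' := by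
      intro b hbs hbt
      constructor
      · show blockOf b.src ∈ S
        rcases hbs with h | h <;> rw [h]
        exacts [hcs, hct]
      · show blockOf b.tgt ∈ S
        rcases hbt with h | h <;> rw [h]
        exacts [hcs, hct]
    refine differentiableAt_coe_emlAvgU_of_twoBlock (F := fun x : E => emlIterU i (F x)) hi c
      (fun b hbs hbt => hF b (hmem b hbs hbt).1 (hmem b hbs hbt).2) ?_
    have h30 : 0 ≤ 30 * ℓ * (P.L : ℝ) ^ i * s₀ := by positivity
    have hlt : 4 * (((P.d + 2) * P.L : ℕ) : ℝ) * (30 * ℓ * (P.L : ℝ) ^ i * s₀) < 1 := by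
      rw [← hℓ]
      have : 4 * ℓ * (30 * ℓ * (P.L : ℝ) ^ i * s₀) = (120 / 6400) * (6400 * ℓ ^ 2 * (P.L : ℝ) ^ i * s₀) := by ring
      rw [this]; nlinarith
    exact norm_loopHolU_sub_one_lt_one hi c h30 hlt fun b hbs hbt => hnear b (hmem b hbs hbt).1 (hmem b hbs hbt).2

/-! ## §2 The gauged perturbed family and the un-gauging -/

omit [NormOneClass 𝔸] in
/-- **BONDWISE DIFFERENTIABILITY OF THE GAUGED PERTURBED FAMILY**: `A ↦ (e^{iηA}·V)^{û}(b) = û(b₋)·e^{iηA(b)}·V(b)·û(b₊)⁻¹` (constants times the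
exponential). [cite: Balaban1985Variational, (152) p.301; Balaban1985Averaging, (8) p.19] -/
theorem differentiableAt_coe_gaugeActT_mul (û : GaugeTransf P 0 𝔸ˣ) (η : ℝ) (V : GaugeField P 0 𝔸ˣ) (b : PBond P 0) (A₀ : PBond P 0 → 𝔸) :
    DifferentiableAt ℂ (fun A : PBond P 0 → 𝔸 => ((gaugeActT û (fun b => expCfg η A b * V b) b : 𝔸ˣ) : 𝔸)) A₀ := by
  have h : (fun A : PBond P 0 → 𝔸 => ((gaugeActT û (fun b => expCfg η A b * V b) b : 𝔸ˣ) : 𝔸)) =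
      fun A => ((û b.src : 𝔸ˣ) : 𝔸) * ((expCfg η A b : 𝔸ˣ) : 𝔸) * (((V b : 𝔸ˣ) : 𝔸) * (((û b.tgt)⁻¹ : 𝔸ˣ) : 𝔸)) := by
    funext A; rw [gaugeActT_apply]; simp only [Units.val_mul]; noncomm_ring
  rw [h]
  exact ((differentiableAt_coe_expCfg η b A₀).const_mul _).mul_const _

omit [NormOneClass 𝔸] in
/-- **UN-GAUGING THE ITERATE**: `Ū^{(k)}[V](e) = û^{(k)}(e₋)⁻¹·Ū^{(k)}[V^{û}](e)·û^{(k)}(e₊)` (`Prop8Chart.emlIterU_gaugeActT` at the family `transfUp û`).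
[cite: Balaban1985Averaging, (11)-(12) p.19] -/
theorem coe_emlIterU_eq_conj_gauged (û : GaugeTransf P 0 𝔸ˣ) (V : GaugeField P 0 𝔸ˣ) (k : ℕ) (e : PBond P k) :
    ((emlIterU k V e : 𝔸ˣ) : 𝔸) =
      (((transfUp û k e.src)⁻¹ : 𝔸ˣ) : 𝔸) * ((emlIterU k (gaugeActT û V) e : 𝔸ˣ) : 𝔸) * ((transfUp û k e.tgt : 𝔸ˣ) : 𝔸) := by
  have hus : ∀ (i : ℕ) (y : Site P (i + 1)), transfUp û (i + 1) y = transfUp û i (emb y) := fun _ _ => rfl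
  have h₁ : emlIterU k (gaugeActT û V) e = transfUp û k e.src * emlIterU k V e * (transfUp û k e.tgt)⁻¹ := by
    rw [show gaugeActT û V = gaugeActT (transfUp û 0) V from rfl, emlIterU_gaugeActT (transfUp û) hus V k, gaugeActT_apply]
  have key : emlIterU k V e = (transfUp û k e.src)⁻¹ * emlIterU k (gaugeActT û V) e * transfUp û k e.tgt := by
    rw [h₁]; group
  have := congrArg (fun z : 𝔸ˣ => (z : 𝔸)) key
  simpa only [Units.val_mul] using this

end Generic

/-! ## §3 The SU(2) background in the cluster axial gauge: differentiability of the relative iterate -/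

section SU2

open scoped Matrix.Norms.L2Operator

/-- **(AVG-SYM-AN) — ℂ-DIFFERENTIABILITY OF THE RELATIVE k-FOLD (0.4) AVERAGE AT A CURVED, PLAQUETTE-SMALL SU(2) BACKGROUND.**  Let `U₀` have every plaquette
within `a₀ > 0` of `1`, `k + 1 ≤ m + K`, let `‖ηA₀(b)‖ ≤ t ≤ 1` bondwise, and put `s_B := 2d(3Lᵏ − 1)a₀`, `s₀ := 2t(1 + s_B) + s_B` with the budget `6400ℓ²Lᵏs₀ ≤ 1`;
then for EVERY `k`-bond `e` the map `A ↦ Ū^{(k)}[e^{iηA}·U₀♭](e)·(Ū^{(k)}[U₀♭](e))⁻¹` is ℂ-differentiable at `A₀` — the relative quantity of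
`Prop7SymAvgRelativeBound.norm_relIter_sub_one_le_of_plaqSmall` is HOLOMORPHIC on the same k-uniform sup-ball.  Proof: cluster axial gauge `u = axialT U₀ (embIter k e₋)`,
§1 for the gauged family (reads `s₀` by `norm_reads_gauged_product_le`), §2 to undo the gauge (constants).
[cite: Balaban1987RG1, (0.4) p.253, (0.21) p.256; Balaban1985Averaging, (11)-(12) p.19, Prop. 4 (134)-(135) p.38; Balaban1985Variational, (152) p.301] -/
theorem differentiableAt_relIter_of_plaqSmall {k : ℕ} (hk : k + 1 ≤ P.m + P.K) (U₀ : GaugeField P 0 (Matrix.specialUnitaryGroup (Fin 2) ℂ))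
    {a₀ : ℝ} (ha₀ : 0 < a₀) (hU : PlaqSmall a₀ U₀) (η : ℝ) (A₀ : PBond P 0 → Matrix (Fin 2) (Fin 2) ℂ) {t : ℝ} (ht1 : t ≤ 1)
    (hA : ∀ b, ‖(η : ℂ) • A₀ b‖ ≤ t)
    (hbudget : 6400 * (((P.d + 2) * P.L : ℕ) : ℝ) ^ 2 * (P.L : ℝ) ^ k *
      (2 * t * (1 + 2 * ((P.d : ℝ) * (3 * (P.L : ℝ) ^ k - 1)) * a₀) + 2 * ((P.d : ℝ) * (3 * (P.L : ℝ) ^ k - 1)) * a₀) ≤ 1)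
    (e : PBond P k) :
    DifferentiableAt ℂ (fun A : PBond P 0 → Matrix (Fin 2) (Fin 2) ℂ =>
      ((emlIterU k (fun b => expCfg η A b * unitsField (toUField U₀) b) e : (Matrix (Fin 2) (Fin 2) ℂ)ˣ) : Matrix (Fin 2) (Fin 2) ℂ) *
        (((emlIterU k (unitsField (toUField U₀)) e)⁻¹ : (Matrix (Fin 2) (Fin 2) ℂ)ˣ) : Matrix (Fin 2) (Fin 2) ℂ)) A₀ := by
  set sB : ℝ := 2 * ((P.d : ℝ) * (3 * (P.L : ℝ) ^ k - 1)) * a₀ with hsB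
  set s₀ : ℝ := 2 * t * (1 + sB) + sB with hs₀
  set z := e.src with hz
  set u : GaugeTransf P 0 (Matrix.specialUnitaryGroup (Fin 2) ℂ) := axialT U₀ (embIter k z) with hu
  set û : GaugeTransf P 0 (Matrix (Fin 2) (Fin 2) ℂ)ˣ := fun x => Unitary.toUnits (suIncl (u x)) with hû
  set V₂ : GaugeField P 0 (Matrix (Fin 2) (Fin 2) ℂ)ˣ := unitsField (toUField U₀) with hV₂
  have ht0 : 0 ≤ t := (norm_nonneg _).trans (hA ⟨embIter k e.src, e.dir⟩)
  have hL1 : (1 : ℝ) ≤ P.L := by exact_mod_cast P.L_pos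
  have hsB0 : 0 ≤ sB := by
    rw [hsB]
    have h3 : (0 : ℝ) ≤ 3 * (P.L : ℝ) ^ k - 1 := by linarith [one_le_pow₀ (n := k) hL1]
    positivity
  have hs₀0 : 0 ≤ s₀ := by rw [hs₀]; positivity
  -- the cluster: both ends of `e`
  set S : Set (Site P k) := {w | w = z ∨ w = z.shift e.dir ∨ w = z.shift e.dir ∨ w = (z.shift e.dir).shift e.dir} with hS
  have hsrc : e.src ∈ S := Or.inl hz.symm
  have htgt : e.tgt ∈ S := Or.inr (Or.inl rfl)
  -- reads of the gauged background and of the gauged perturbed field at `A₀`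
  have hreads₂ : ∀ b : PBond P 0, iterBlockOf k b.src ∈ S → iterBlockOf k b.tgt ∈ S →
      ‖((gaugeActT û V₂ b : (Matrix (Fin 2) (Fin 2) ℂ)ˣ) : Matrix (Fin 2) (Fin 2) ℂ) - 1‖ ≤ sB := by
    intro b hbs hbt
    rw [hû, hV₂, ← unitsField_toUField_gaugeActT, coe_unitsField_toUField, ← SU2Mean.dist1_eq_norm, hu]
    exact dist1_axial_cluster_le hk U₀ ha₀ hU z e.dir e.dir b hbs hbt
  have hE : ∀ b : PBond P 0, ‖((expCfg η A₀ b : (Matrix (Fin 2) (Fin 2) ℂ)ˣ) : Matrix (Fin 2) (Fin 2) ℂ) - 1‖ ≤ 2 * t := by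
    intro b
    have hI : ‖(Complex.I * (η : ℂ)) • A₀ b‖ = ‖(η : ℂ) • A₀ b‖ := by rw [mul_smul, norm_smul, Complex.norm_I, one_mul]
    rw [coe_expCfg]
    calc _ ≤ 2 * ‖(Complex.I * (η : ℂ)) • A₀ b‖ := B7TransferAnalyticMean.norm_exp_sub_one_le_two_mul (by rw [hI]; exact (hA b).trans ht1)
      _ ≤ 2 * t := by rw [hI]; linarith [hA b]
  have hreads₁ : ∀ b : PBond P 0, iterBlockOf k b.src ∈ S → iterBlockOf k b.tgt ∈ S →
      ‖((gaugeActT û (fun b => expCfg η A₀ b * V₂ b) b : (Matrix (Fin 2) (Fin 2) ℂ)ˣ) : Matrix (Fin 2) (Fin 2) ℂ) - 1‖ ≤ s₀ := by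
    intro b hbs hbt
    rw [hs₀]
    exact norm_reads_gauged_product_le u (expCfg η A₀) V₂ b (hE b) (hreads₂ b hbs hbt)
  -- §1 for the gauged family
  have hbud : 6400 * (((P.d + 2) * P.L : ℕ) : ℝ) ^ 2 * (P.L : ℝ) ^ k * s₀ ≤ 1 := hbudget
  have hdiff : DifferentiableAt ℂ (fun A : PBond P 0 → Matrix (Fin 2) (Fin 2) ℂ =>
      ((emlIterU k (gaugeActT û (fun b => expCfg η A b * V₂ b)) e : (Matrix (Fin 2) (Fin 2) ℂ)ˣ) : Matrix (Fin 2) (Fin 2) ℂ)) A₀ :=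
    differentiableAt_coe_emlIterU_family_of_reads (fun A : PBond P 0 → Matrix (Fin 2) (Fin 2) ℂ => gaugeActT û (fun b => expCfg η A b * V₂ b)) A₀
      (fun b => differentiableAt_coe_gaugeActT_mul û η V₂ b A₀) k (Nat.le_of_succ_le hk) S s₀ hs₀0 hbud hreads₁ e hsrc htgt
  -- undo the gauge: the un-gauged iterate is the gauged one between two constants
  have hfun : (fun A : PBond P 0 → Matrix (Fin 2) (Fin 2) ℂ =>
      ((emlIterU k (fun b => expCfg η A b * V₂ b) e : (Matrix (Fin 2) (Fin 2) ℂ)ˣ) : Matrix (Fin 2) (Fin 2) ℂ) *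
        (((emlIterU k V₂ e)⁻¹ : (Matrix (Fin 2) (Fin 2) ℂ)ˣ) : Matrix (Fin 2) (Fin 2) ℂ)) =
      fun A => (((transfUp û k e.src)⁻¹ : (Matrix (Fin 2) (Fin 2) ℂ)ˣ) : Matrix (Fin 2) (Fin 2) ℂ) *
        ((emlIterU k (gaugeActT û (fun b => expCfg η A b * V₂ b)) e : (Matrix (Fin 2) (Fin 2) ℂ)ˣ) : Matrix (Fin 2) (Fin 2) ℂ) *
        (((transfUp û k e.tgt : (Matrix (Fin 2) (Fin 2) ℂ)ˣ) : Matrix (Fin 2) (Fin 2) ℂ) *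
          (((emlIterU k V₂ e)⁻¹ : (Matrix (Fin 2) (Fin 2) ℂ)ˣ) : Matrix (Fin 2) (Fin 2) ℂ)) := by
    funext A
    rw [coe_emlIterU_eq_conj_gauged û (fun b => expCfg η A b * V₂ b) k e, mul_assoc]
  rw [hfun]
  exact (hdiff.const_mul _).mul_const _

end SU2

end Summit.QuantumFields.YangMills.Theorems.Prop7SymAvgRelativeBound

end
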